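import Literature.MathematicalPhysics.QuantumFieldTheory.Balaban1983to89.Node00.Carriers2
import Literature.MathematicalPhysics.QuantumFieldTheory.Balaban1983to89.Node00.NonVacuity
import Literature.MathematicalPhysics.QuantumFieldTheory.Balaban1983to89.Node00.NonVacuityB7

/-!
# NODE 00 (YM-PLAN Track A) — NON-VACUITY AT THE PARAMETERS OF RECORD: for every ADMISSIBLE `θ` the carrier bundles of record
# `carriers₁ θ X` (Stage 1: B4 + B5 groups) and `carriers₂ θ X` (Stage 2: + B7 group) have INHABITED index types and, conjunct by
# conjunct, members meeting the printed antecedents — stated ON THE BUNDLES' OWN FIELDS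

NODE 00 CELL FILE (seat `pub-ymgap-node00-def`, g5, 2026-08-24; report NODE00-SCOPING.md §3 F3 ∕ §5 Q-N00-6; pub-ymgap lead R302).  WAVE 3
(imports the root `Node00Carriers` through `Node00Carriers2`, and the two raw-parameter non-vacuity modules `Node00NonVacuity` (index half),
`Node00NonVacuityB7` (hypothesis half at the [Balaban1985Averaging] carriers)); theorems only; count-neutral; NOT proposed (R296).

WHY THIS MODULE EXISTS.  The raw modules speak about the lineage structures at free parameters `(d, ℓ, a₋, a₊, m²₊, …)`; the worlds of record
are indexed by `θ : Stage1Params` ∕ `Stage2Params` under `θ.Admissible`, whose LAST conjunct `0 ≤ m²₊` (R302, item e3) is exactly what makes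
the two window-indexed [Balaban1983RegularityDecay] index types non-empty.  Here the two halves are instantiated AT `θ` and transported
(definitionally — the pinned groups of `carriers₁ ∕ carriers₂` ARE the lineage families, `Node00CarriersFrame.carriers₁_groupB4`,
`Node00Carriers2Frame.leaves_carriers₂_pinned`) onto the fields of the bundles themselves: §1 every pinned index type `(carriers₁ θ X).I4E ∕ I4U ∕
I4F ∕ I5`, `(carriers₂ θ X).I7a … I7e` is inhabited; §2 for every threshold `e₁ > 0` the three B4 families of `carriers₁ θ X` have members meeting
the antecedents of Theorem p. 573 ∕ Prop. 2.3 ∕ Prop. 3.1′ (`regular`, `bigBlocks` ∕ `unitBlocks`, `reg121`, `0 < e ≤ e₁`) — the r01 lineage's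
`B4LeafRegular.leafNN_torusPairFam_nonvacuous` at `θ`; §3 for all positive thresholds the five B7 families of `carriers₂ θ X` have data meeting
every antecedent of Props. 1–10 (`Node00NonVacuityB7.concl_concrete_antecedents_met` at `θ`).  So at the objects of record no conjunct of the
`b4` ∕ `b7` leaves is discharged over an empty family or through unsatisfiable hypotheses; the B5 leaf (`B5.MainBlock`: Props. 1.1 ∕ 1.2, (1.67))
has no instance-level antecedents — its only sanity condition is §1's `I5`.
HONEST FRAMING: sanity layers of the vacuity standard; the per-FIELD genuineness of the families is the cross-read (report App. A–G).  One finite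
T⁴ programme, NOT continuum ∕ infinite volume ∕ OS ∕ mass gap ∕ Clay.
-/

noncomputable section

namespace Literature.MathematicalPhysics.QuantumFieldTheory.Balaban1983to89.Node00

open DagBinding DagDischargedII
open B4LeafRegular (leafNN_torusPairFam_nonvacuous)

/-! ## §1. Index half at `θ`: every pinned index type of the bundles of record is inhabited -/

/-- **Stage 1, admissible `θ`: the four pinned index types of `carriers₁ θ X` are inhabited** — B4's torus region pairs `I4E`, nested regular
regions `I4U` (both need `a₋ ≤ a₊` AND the last admissibility conjunct `0 ≤ m²₊`), regular forms `I4F`, and B5's top-level tori `I5` (`D ≥ 1`, `L`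
odd `> 1`). [cite: Balaban1983RegularityDecay, (1.6) p.572, (1.13)–(1.14) p.573, Props. 2.3 / 3.1′ p.574; Balaban1984PropagatorsI, (1.1)–(1.6) pp.18–19 — dictionary ∕ bookkeeping] -/
theorem nonempty_indices₁_of_admissible (θ : Stage1Params) (hθ : θ.Admissible) (X : PrintedCarriersR) :
    Nonempty (carriers₁ θ X).I4E ∧ Nonempty (carriers₁ θ X).I4U ∧ Nonempty (carriers₁ θ X).I4F ∧ Nonempty (carriers₁ θ X).I5 := by
  obtain ⟨hD, hap, _, _, _, _, _, _, _, _, _, _, hm2⟩ := hθ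
  exact ⟨nonempty_torusPairInst _ _ hap hm2, nonempty_regularRegionIdxW _ _ _ hap hm2, nonempty_regularFormInstance _,
    nonempty_topIdx (le_trans one_le_two hD) θ.hL⟩

/-- **Stage 2, admissible `θ`: all nine pinned index types of `carriers₂ θ X` are inhabited** — the four of Stage 1 and B7's `I7a` (plaquette–bond
pairs, `D ≥ 2`), `I7b = ℕ`, `I7c` (k-fold bonds), `I7d` (gauge backgrounds: the unit background satisfies (52) at `α₀ = c₂ > 0`), `I7e = PUnit`.
[cite: Balaban1983RegularityDecay, pp.572–574; Balaban1984PropagatorsI, pp.18–19; Balaban1985Averaging, (51)–(52) p.26, (127) p.37, (177) p.45 — dictionary ∕ bookkeeping] -/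
theorem nonempty_indices₂_of_admissible (θ : Stage2Params) (hθ : θ.toStage1Params.Admissible) (X : PrintedCarriersR) :
    (Nonempty (carriers₂ θ X).I4E ∧ Nonempty (carriers₂ θ X).I4U ∧ Nonempty (carriers₂ θ X).I4F ∧ Nonempty (carriers₂ θ X).I5) ∧
      Nonempty (carriers₂ θ X).I7a ∧ Nonempty (carriers₂ θ X).I7b ∧ Nonempty (carriers₂ θ X).I7c ∧ Nonempty (carriers₂ θ X).I7d ∧
        Nonempty (carriers₂ θ X).I7e := by
  refine ⟨nonempty_indices₁_of_admissible θ.toStage1Params hθ _, ?_, ⟨(0 : ℕ)⟩, ?_, ?_, ⟨PUnit.unit⟩⟩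
  · exact nonempty_idx hθ.1
  · exact nonempty_kIdx (le_trans one_le_two hθ.1)
  · exact nonempty_gIdx θ.𝔸 θ.D (le_of_lt θ.hL.2)

/-! ## §2. Hypothesis half at `θ`, B4 group: members of the three families of record meeting the printed antecedents -/

/-- **Stage 1, admissible `θ`, every threshold `e₁ > 0`: the three [Balaban1983RegularityDecay] families OF `carriers₁ θ X` have members meeting
their conjunct's antecedents** — Theorem p. 573's `regular ∧ bigBlocks ∧ 0 < e ≤ e₁` in `famE`, Prop. 2.3's in `famU`, Prop. 3.1′'s `unitBlocks ∧
reg121 ∧ 0 < e ≤ e₁` in `famF` (the r01 lineage's `leafNN_torusPairFam_nonvacuous` at `θ`'s flow, dimension `D − 1`, block `L − 1`, windows and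
constants; it consumes `a₋ ≤ a₊`, `0 ≤ m²₊`, `c ≥ 0`, `β > 0`, `a′ > 0`, `a > 0`, `m² ≥ 0`, `O(1) ≥ 0`, `a₀ ≥ 0`, `p > 0` of `θ.Admissible`).
[cite: Balaban1983RegularityDecay, Theorem p.573, Prop. 2.3 of [1] p.574, Prop. 3.1′ of [2] p.574 («for e sufficiently small») — kernel version of the lit-balaban r01 lineage, instantiated] -/
theorem b4_antecedents_met_of_admissible (θ : Stage1Params) (hθ : θ.Admissible) (X : PrintedCarriersR) (e₁ : ℝ) (he₁ : 0 < e₁) :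
    (∃ i : (carriers₁ θ X).I4E, ((carriers₁ θ X).famE i).regular ∧ ((carriers₁ θ X).famE i).bigBlocks ∧
        0 < ((carriers₁ θ X).famE i).e ∧ ((carriers₁ θ X).famE i).e ≤ e₁) ∧
      (∃ i : (carriers₁ θ X).I4U, ((carriers₁ θ X).famU i).regular ∧ ((carriers₁ θ X).famU i).bigBlocks ∧
        0 < ((carriers₁ θ X).famU i).e ∧ ((carriers₁ θ X).famU i).e ≤ e₁) ∧
      (∃ i : (carriers₁ θ X).I4F, ((carriers₁ θ X).famF i).unitBlocks ∧ ((carriers₁ θ X).famF i).reg121 ∧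
        0 < ((carriers₁ θ X).famF i).e ∧ ((carriers₁ θ X).famF i).e ≤ e₁) := by
  obtain ⟨_, hap, hcreg, hβ, ha', ha0, hm, hC, ha₀, hp, _, _, hm2⟩ := hθ
  exact (leafNN_torusPairFam_nonvacuous θ.F (θ.D - 1) θ.hℓ₁ θ.hLip (θ.L - 1) θ.one_le_pred θ.amin θ.aplus θ.m2plus θ.ha hap hm2
    θ.creg θ.β hcreg hβ ha' ha0 hm hC ha₀ hp θ.d₅ θ.N₅).2 e₁ he₁

/-! ## §3. Hypothesis half at `θ`, B7 group: data of the five families of record meeting every antecedent of Props. 1–10 -/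

/-- **Stage 2, every `θ` (`L` odd `> 1`), all positive thresholds: the five [Balaban1985Averaging] families OF `carriers₂ θ X` carry data meeting
every antecedent of Props. 1–10 AS TYPED** — (44)∕(52) small-field, (109) field bound, (166)–(167), (176)–(177), (180) — by the unit configuration,
zero fields and identity gauge transformations (`Node00NonVacuityB7.concl_concrete_antecedents_met` at `θ`; the gauge-transformation family's
background antecedent at its unit-background index of the given order `k`). [cite: Balaban1985Averaging, Props. 1–10 pp.26–50 — bookkeeping over the r04 carriers, instantiated] -/
theorem b7_antecedents_met (θ : Stage2Params) (X : PrintedCarriersR) (i₁ : (carriers₂ θ X).I7a) (k : (carriers₂ θ X).I7b)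
    (i₃ : (carriers₂ θ X).I7c) {α₀ α₁ α₃ α₄ : ℝ} (hα₀ : 0 < α₀) (hα₁ : 0 < α₁) (hα₃ : 0 < α₃) (hα₄ : 0 < α₄) :
    (∃ (V : ((carriers₂ θ X).one7 i₁).Cfg) (A : ((carriers₂ θ X).one7 i₁).Fld),
        ((carriers₂ θ X).one7 i₁).plaqDev V < α₀ ∧ ((carriers₂ θ X).one7 i₁).fldNorm A < α₁) ∧
      (∃ U : ((carriers₂ θ X).kst7 k).Cfg, ((carriers₂ θ X).kst7 k).plaqDevEta U < α₀) ∧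
      (∃ (U₀ : ((carriers₂ θ X).kexp7 i₃).Cfg) (A : ((carriers₂ θ X).kexp7 i₃).Fld),
        ((carriers₂ θ X).kexp7 i₃).plaqDevEta U₀ < α₀ ∧ ((carriers₂ θ X).kexp7 i₃).fldNorm A < α₁) ∧
      (∃ i : (carriers₂ θ X).I7d, ((carriers₂ θ X).gd7 i).k = k ∧
        ∃ (U₀ : ((carriers₂ θ X).gd7 i).Cfg) (u : ((carriers₂ θ X).gd7 i).GT),
          ((carriers₂ θ X).gd7 i).plaqDevEta U₀ < α₀ ∧ ((carriers₂ θ X).gd7 i).InLambda U₀ α₃ u ∧ ((carriers₂ θ X).gd7 i).Reg176 α₄ u) ∧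
      (∃ (V₀ : ((carriers₂ θ X).gone7 PUnit.unit).Cfg) (v' v₁ : ((carriers₂ θ X).gone7 PUnit.unit).GT),
        ((carriers₂ θ X).gone7 PUnit.unit).plaqDev V₀ < α₀ ∧ ((carriers₂ θ X).gone7 PUnit.unit).dev v' < α₄ ∧
          ((carriers₂ θ X).gone7 PUnit.unit).covDev V₀ v' < α₄ ∧ ((carriers₂ θ X).gone7 PUnit.unit).dev v₁ < α₃ ∧
            ((carriers₂ θ X).gone7 PUnit.unit).blockCovDev V₀ v₁ < (carriers₂ θ X).L7 * α₃) :=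
  concl_concrete_antecedents_met θ.𝔸 θ.D θ.L (le_of_lt θ.hL.2) i₁ k i₃ hα₀ hα₁ hα₃ hα₄

/-! ## §4. At the worlds of record -/

/-- **At every binding world of record, Stage 1, every run**: the upstream block is the N-binding over a bundle `carriers₁ θ X` (admissible `θ`)
whose four pinned index types are inhabited and whose three B4 families meet their antecedents below every threshold — so the leaves `b4`, `b5`
that N01 ∕ N02 assert there are statements about non-empty, non-degenerate families. [cite: Balaban1983RegularityDecay, Theorem p.573, Props. 2.3 / 3.1′ p.574; Balaban1984PropagatorsI, Props. 1.1–1.2 pp.33–36 — bookkeeping] -/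
theorem isWorldOfRecord₁_nonvacuous (w : WorldP) (hw : IsWorldOfRecord₁ w) (P : B12.RunParams) :
    ∃ (θ : Stage1Params) (X : PrintedCarriersR) (Y : PrintedCarriers9X) (Z : PrintedCarriers11) (V : PrintedCarriers14R)
      (W : PrintedCarriers15), θ.Admissible ∧ w.up P = Upstream.ofPrintedAllXPN (carriers₁ θ X) Y Z V W ∧
      (Nonempty (carriers₁ θ X).I4E ∧ Nonempty (carriers₁ θ X).I4U ∧ Nonempty (carriers₁ θ X).I4F ∧ Nonempty (carriers₁ θ X).I5) ∧
      ∀ e₁ : ℝ, 0 < e₁ →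
        (∃ i : (carriers₁ θ X).I4E, ((carriers₁ θ X).famE i).regular ∧ ((carriers₁ θ X).famE i).bigBlocks ∧
            0 < ((carriers₁ θ X).famE i).e ∧ ((carriers₁ θ X).famE i).e ≤ e₁) ∧
          (∃ i : (carriers₁ θ X).I4U, ((carriers₁ θ X).famU i).regular ∧ ((carriers₁ θ X).famU i).bigBlocks ∧
            0 < ((carriers₁ θ X).famU i).e ∧ ((carriers₁ θ X).famU i).e ≤ e₁) ∧
          (∃ i : (carriers₁ θ X).I4F, ((carriers₁ θ X).famF i).unitBlocks ∧ ((carriers₁ θ X).famF i).reg121 ∧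
            0 < ((carriers₁ θ X).famF i).e ∧ ((carriers₁ θ X).famF i).e ≤ e₁) := by
  obtain ⟨θ, hθ, hup⟩ := hw
  obtain ⟨X, Y, Z, V, W, hP⟩ := hup P
  exact ⟨θ, X, Y, Z, V, W, hθ, hP, nonempty_indices₁_of_admissible θ hθ X, fun e₁ he₁ => b4_antecedents_met_of_admissible θ hθ X e₁ he₁⟩

end Literature.MathematicalPhysics.QuantumFieldTheory.Balaban1983to89.Node00

end
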